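import Summits.CriticalPhenomena.SAWScalingLimit.Theses.SAWTotalPositivity

/-!
# Line `power-law-tp2` for crux `SAWTotalPositivity.TPToTraversalBound` (stmt-CriticalPhenomena-10687)

Skeleton (crux-plan, planner-cruxplan-stmt-CriticalPhenomena-10687-power-law-tp2-0, 2026-08-16) of the
crux idea `Cruxes/TPToTraversalBound/Ideas/power-law-tp2.md` (ideator 2, round 1; triage r1-1/2/3: pass,
"merge with long-rooms-pair-short-sides: PTP ≡ TP2Gap + proved sub-multiplicativity; plumb through
same-source likelihood RATIOS (target switching, optional stopping), never through un-normalised tip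
masses (BN2)").

The crux is literally `BoundaryTP2 → CriticalBubbleBound → SAWTraversalBound` (`Disproof.iff_imp`).
THE LINE (five registered stubs, composed at the bottom):

* `stub_tp2Gap` — **the SAW-specific seed** (Disproof F4 demands one: abstract TP₂ + bubble + planarity
  are consistent with `¬ SAWTraversalBound`): circular TP₂ with a GAP at one separated modulus — for an
  interlaced quadruple `(p₁,p₂,p₃,p₄)` whose deep pair `{p₂,p₃}` is joined inside the closed disc
  `B̄(z₀,ρ)` and whose outer pair `{p₄,p₁}` is joined outside the open disc `B(z₀,Λ₀ρ)`, the crossing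
  pairing weighs at most `θ < 1` times the nested one, uniformly in the domain, the mesh and the walls,
  for lattice-fat `ρ ≥ ρ₀δ` (`TP2Gap`; = card PTP at `K = 1/θ`; = long-rooms K1).
* `stub_ptp_of_gap` — **power-law TP₂ with a rate**: `BoundaryTP2 → TP2Gap → PTP` by Fekete along
  circles (door lemma = two TP₂ instances ⇒ cross-ratio sub-multiplicativity, PROVED in
  `Cruxes/TPToTraversalBound/Sketch.lean` as `crossRatioSubmult_of_boundaryTP2`; seed in each sub-room).
* `stub_unforcedDive` — **THE BET (hardest)**: `BoundaryTP2 → CriticalBubbleBound → TP2Gap → PTP →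
  UnforcedDiveBound`, Kemppainen–Smirnov's Condition G2/G3 for the critical SAW, typed on the lattice
  (Vocabulary B): after ANY self-avoiding prefix, the future ever makes a DIVE of a given annulus (a
  traversal landing at strictly higher traversal index behind an avoidable component) with conditional
  probability `≤ ε`, for annuli of aspect `≥ C₀(ε)` (KS's power-law form G3).  Mechanism (the
  card's SMLR, in the local form in which it is true): the target-switching likelihood ratio
  `N = Σ_{c ∈ J_P} W_c/W_b` with `J_P` the dead end behind ONE avoidable component `P`, observed at the
  ENTRANCE time of `P`, gains `≥ e^{c·m(P)}` by the completion of the traversal of `P` (TP₂-MLR sandwich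
  in the slit domain + PTP/TP2Gap door-by-door for the gain + reverse Simon–Lieb / one-step Harnack from
  the bubble constant for the gluing); optional stopping per pocket; the pockets of one annulus are
  counted by extremal length (`#{P : m(P) ≤ m} ≤ 2π m / log C₀`).
* `stub_multiDive_of_unforced` — nested optional stopping: `UnforcedDiveBound → MultiDiveBound`, the
  clock-annulus / charged-window pattern bound (judge at canonical clock-traversal times `E m_k`; a dive of
  the `k`-th charged annulus, judged then and completed before the next judging time, costs `ε` each).
* `stub_traversalBound_of_multiDive` — lattice Kemppainen–Smirnov Prop. 3.5 / Lemma 3.6 and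
  Aizenman–Burchard bookkeeping: `UnforcedDiveBound → MultiDiveBound → SAWTraversalBound` (clock `A₂`,
  charged `A₁,A₂,A₃`; index `±1` per clock step; `≥ (n - n₀)/2` charges among `n` traversals;
  `n₀ ≤ m_D(x,ρ,R)` uniformly in the mesh from the Jordan boundary's modulus of continuity; threshold
  `k = 3 m_D + ⌈3 log₂(R/ρ)⌉ + O(1)`, `λ = 3`; polyline traversals ⇒ lattice traversals of the shell
  shrunk by one mesh).
* `TPToTraversalBound_of` — the kernel-checked composition
  `fun hTP hB => let hU := S3 hTP hB S1 (S2 hTP S1); S5 hU (S4 hU)`.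

What was typed and then DISCARDED this session (recorded so that nobody re-files it): the pointwise SMLR
"`q₀ · W_b(ext η++κ) · W_J(ext η) ≤ W_J(ext η++κ) · W_b(ext η)` for every dive `κ`" with a GLOBAL target set
`J` judged at the prefix `η` is false in legal geometries (a long forced excursion between two pockets of
the same annulus: `N_0` is dominated by the route-near pocket and a dive into the far one cannot be paid
at time `η`); with a pure-index notion of dive the G2 analogue itself is false (corridor of width `4r` with
the inner disc in its middle: entering it is index-increasing with probability `O(1)`); and first-traversal
dive bounds do not feed KS Lemma 3.6.  Hence: avoidability inside `Targets`, the "ever" form of the dive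
bound, the charged-window pattern form, and SMLR demoted to the local mechanism of stub 3.

Disproof.lean (v6, cdisprove) honoured: F1/F4 — the only SAW-specific seed is `TP2Gap`, stated at ONE
separated modulus (not at clustered quadruples, where TP₂ is asymptotically tight); F2(iii)/F3 — the
threshold `k` is shell-dependent and absorbs the forced count, `K, λ, δ₀` depend on `(D,a,b)`; F2(v)/§6
(`exists_isEndpointApprox_deepStart`) — deep starts make the slit graph doubly connected, where KS's
component-avoidability alone mis-fires (every component avoidable), which is why a dive is typed as
index-increasing AND avoidable; F6/F7 (landed `Theorems/TPToTraversalBound/Negative/AnnulusPairingGapFalse`,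
`RimPushMonotoneFalse`) — every statement over a fixed continuum domain carries a mesh ceiling
`δ ≤ δ₀(D,a,b)`, the room statements are lattice-fat (`ρ ≥ ρ₀ δ`) and metric (no rim/wall proviso to
mistype), and the metric separation excludes the degenerate `pᵢ = pⱼ` instances not already vacuous by
the interlacing provisos.  No `_false_without_` theorem exists for this crux
(`Disproof.not_traversalBound_of_not_without`: none can unless (H1) fails); the line USES `BoundaryTP2` in
stubs 2–3 and `CriticalBubbleBound` in stub 3.
-/

namespace Summit.CriticalPhenomena.SAWScalingLimit.Cruxes.TPToTraversalBound.PowerLawTp2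

open Literature.Probability.RandomPlanarGeometry Literature.Probability.LatticeModels
open Summit.CriticalPhenomena.SAWScalingLimit.Theses.SAWTotalPositivity
open scoped ENNReal

set_option linter.unusedVariables false

noncomputable section

/-! ## Vocabulary A — rooms: interlaced quadruples with metric separation -/

/-- The critical SAW boundary kernel `Z_Ω(u,v) = Σ_{γ : u → v} x_c^{|γ|}` (total mass of `SAW.weight`). -/
abbrev Z (Ω : Set ℂ) (δ : ℝ) (u v : Site 2) : ℝ≥0∞ := SAW.weight Ω δ u v Set.univ

/-- The three intrinsic provisos of `BoundaryTP2` for the cyclic quadruple `(p₁,p₂,p₃,p₄)` (verbatim):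
the crossing pairs `{p₁,p₃}`, `{p₂,p₄}` always meet; both non-crossing pairings are disjointly realisable. -/
def Interlaced (Ω : Set ℂ) (δ : ℝ) (p₁ p₂ p₃ p₄ : Site 2) : Prop :=
  (∀ (P : SAW.DomainSAW Ω δ p₁ p₃) (Q : SAW.DomainSAW Ω δ p₂ p₄),
      ∃ v, v ∈ P.walk.support ∧ v ∈ Q.walk.support) ∧
  (∃ (P : SAW.DomainSAW Ω δ p₁ p₂) (Q : SAW.DomainSAW Ω δ p₃ p₄),
      List.Disjoint P.walk.support Q.walk.support) ∧
  (∃ (P : SAW.DomainSAW Ω δ p₁ p₄) (Q : SAW.DomainSAW Ω δ p₂ p₃),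
      List.Disjoint P.walk.support Q.walk.support)

/-- Radial position of a site about the centre `z₀` at mesh `δ`. -/
def rad (δ : ℝ) (z₀ : ℂ) (x : Site 2) : ℝ := dist (meshPoint δ x) z₀

/-- `u` and `v` are joined by a walk of `Ω_δ` staying in the CLOSED disc `B̄(z₀, ρ)` (the "deep pair"). -/
def JoinedWithin (Ω : Set ℂ) (δ : ℝ) (u v : Site 2) (z₀ : ℂ) (ρ : ℝ) : Prop :=
  ∃ W : (discreteDomainGraph Ω δ).Walk u v, ∀ x ∈ W.support, rad δ z₀ x ≤ ρ

/-- `u` and `v` are joined by a walk of `Ω_δ` staying OUTSIDE the open disc `B(z₀, R)` (the "outer pair"). -/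
def JoinedBeyond (Ω : Set ℂ) (δ : ℝ) (u v : Site 2) (z₀ : ℂ) (R : ℝ) : Prop :=
  ∃ W : (discreteDomainGraph Ω δ).Walk u v, ∀ x ∈ W.support, R ≤ rad δ z₀ x

/-- **TP2Gap — the seed (strict circular TP₂ at one separated modulus).**  There are `Λ₀`, `ρ₀ ≥ 1`,
`θ < 1` such that in every bounded simply connected domain, at every mesh, for every interlaced
quadruple `(p₁,p₂,p₃,p₄)` whose deep pair `{p₂,p₃}` is joined inside `B̄(z₀,ρ)` and whose outer pair
`{p₄,p₁}` is joined outside `B(z₀,Λ₀ρ)`, with `ρ ≥ ρ₀ δ` (lattice-fat):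
`Z(p₁,p₃)·Z(p₂,p₄) ≤ θ · Z(p₁,p₄)·Z(p₂,p₃)` — "in a long room the crossing pairs weigh at most `θ` times
the short-side pairs".  `BoundaryTP2` is `θ = 1` without separation; the conformal prediction is
`θ(Λ₀) ≍ Λ₀^{-5/4}` (cross-ratio power, boundary exponent 5/8). -/
def TP2Gap : Prop :=
  ∃ Λ₀ ρ₀ θ : ℝ, 1 ≤ ρ₀ ∧ θ < 1 ∧
    ∀ (Ω : Set ℂ) (δ : ℝ) (p₁ p₂ p₃ p₄ : Site 2) (z₀ : ℂ) (ρ R : ℝ),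
      Bornology.IsBounded Ω → SimplyConnectedSpace Ω → 0 < δ → ρ₀ * δ ≤ ρ → Λ₀ * ρ ≤ R →
      Interlaced Ω δ p₁ p₂ p₃ p₄ → JoinedWithin Ω δ p₂ p₃ z₀ ρ → JoinedBeyond Ω δ p₄ p₁ z₀ R →
      Z Ω δ p₁ p₃ * Z Ω δ p₂ p₄ ≤ ENNReal.ofReal θ * (Z Ω δ p₁ p₄ * Z Ω δ p₂ p₃)

/-- **PTP — power-law TP₂ (the card's conjecture, with a rate).**  For every `K` there are `Λ` and
`ρ₀ ≥ 1` such that, under the same hypotheses with separation ratio `Λ`, the nested pairing weighs at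
least `K` times the crossing one: `K · Z(p₁,p₃)Z(p₂,p₄) ≤ Z(p₁,p₄)Z(p₂,p₃)`.  (Card data, exact
enumeration at `x_c`: `R_TP = 3.3, 11, 39, 148` at slot aspect 1..4, ≈ `e³` per unit aspect.) -/
def PTP : Prop :=
  ∀ K : ℕ, ∃ Λ ρ₀ : ℝ, 1 ≤ ρ₀ ∧
    ∀ (Ω : Set ℂ) (δ : ℝ) (p₁ p₂ p₃ p₄ : Site 2) (z₀ : ℂ) (ρ R : ℝ),
      Bornology.IsBounded Ω → SimplyConnectedSpace Ω → 0 < δ → ρ₀ * δ ≤ ρ → Λ * ρ ≤ R →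
      Interlaced Ω δ p₁ p₂ p₃ p₄ → JoinedWithin Ω δ p₂ p₃ z₀ ρ → JoinedBeyond Ω δ p₄ p₁ z₀ R →
      (K : ℝ≥0∞) * (Z Ω δ p₁ p₃ * Z Ω δ p₂ p₄) ≤ Z Ω δ p₁ p₄ * Z Ω δ p₂ p₃

/-! ## Vocabulary B — prefixes, traversals, index, avoidability, dives

All statements below live in the class of the crux's conclusion: a Dobrushin domain `D`, an endpoint
approximation `(a δ, b δ)`, the critical SAW weights on `Ω_δ = discreteDomainGraph D.carrier δ`, meshes
`δ ≤ δ₀(D,a,b)`.  Conditioning on a prefix `η : a δ ⇝ v` is done WITHOUT slit domains: the conditional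
weights are the restricted weights `W_c(ext η) = SAW.weight … (a δ) c (PrefixSet … η)` in the ORIGINAL
domain (exact domain Markov: `W_c(ext η) = x_c^{|η|} · Z_{Ω_δ ∖ η}(v, c)`).

A traversal of the annulus `A(z₀,r,R)` by a lattice walk is an index segment `[i,j]` whose endpoints
lie in the closed inner disc / closed outer complement (either order) and whose interior lies in the open
annulus.  The INDEX of a vertex after the prefix `η` is the least number of traversals a past-avoiding
walk of `Ω_δ` from it to `b δ` must make (Kemppainen–Smirnov's `I(A, U_τ)`, arXiv:1212.6215 §3.2).  The
A-COMPONENT of an annulus vertex is its connected component among the non-past annulus vertices, and it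
is AVOIDABLE when some past-avoiding walk from the tip to `b δ` misses it (KS Def. 2.2).  `Targets η b` =
the non-past vertices of finite, strictly higher index than the tip that can only be reached from the tip
through a traversal inside an avoidable component; a DIVE is a traversal of the future landing in
`Targets`.  Both conditions are needed: avoidability alone mis-fires when the past floats (deep starts,
`Disproof.exists_isEndpointApprox_deepStart`: the slit graph is doubly connected and every component is
avoidable), the index alone mis-fires when the inner disc sits inside a forced corridor. -/

/-- The SAW chords `a → c` of `Ω_δ` extending the lattice prefix `η : a ⇝ v`. -/
def PrefixSet (Ω : Set ℂ) (δ : ℝ) (a c : Site 2) {v : Site 2}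
    (η : (discreteDomainGraph Ω δ).Walk a v) : Set (SAW.DomainSAW Ω δ a c) :=
  {γ | ∃ q : (discreteDomainGraph Ω δ).Walk v c, γ.walk = η.append q}

/-- The segment `[i, j]` of the walk `w` TRAVERSES the annulus `A(z₀, r, R)`: `w i` lies in the closed
inner disc and `w j` outside the open outer disc (or the reverse), and every vertex strictly between lies
in the open annulus. -/
def IsTraversal {Ω : Set ℂ} (δ : ℝ) (z₀ : ℂ) (r R : ℝ) {u v : Site 2}
    (w : (discreteDomainGraph Ω δ).Walk u v) (i j : ℕ) : Prop :=
  i < j ∧ j ≤ w.length ∧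
  ((rad δ z₀ (w.getVert i) ≤ r ∧ R ≤ rad δ z₀ (w.getVert j)) ∨
    (R ≤ rad δ z₀ (w.getVert i) ∧ rad δ z₀ (w.getVert j) ≤ r)) ∧
  ∀ l, i < l → l < j → r < rad δ z₀ (w.getVert l) ∧ rad δ z₀ (w.getVert l) < R

/-- The walk `w` makes at least `n` separate traversals of `A(z₀,r,R)` (index-disjoint, in order). -/
def HasNTrav {Ω : Set ℂ} (δ : ℝ) (z₀ : ℂ) (r R : ℝ) {u v : Site 2}
    (w : (discreteDomainGraph Ω δ).Walk u v) (n : ℕ) : Prop :=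
  ∃ i j : Fin n → ℕ, (∀ m, IsTraversal δ z₀ r R w (i m) (j m)) ∧
    ∀ ⦃m m' : Fin n⦄, m < m' → j m ≤ i m'

/-- `IdxAtLeast … P u b n`: every walk of `Ω_δ` from `u` to `b` that avoids the past `P` after its
start makes at least `n` traversals of `A(z₀,r,R)` ("the traversal index of `u` is `≥ n`"). -/
def IdxAtLeast (Ω : Set ℂ) (δ : ℝ) (z₀ : ℂ) (r R : ℝ) (P : List (Site 2)) (u b : Site 2)
    (n : ℕ) : Prop :=
  ∀ w : (discreteDomainGraph Ω δ).Walk u b, (∀ x ∈ w.support.tail, x ∉ P) → HasNTrav δ z₀ r R w n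

/-- A non-past vertex in the OPEN annulus. -/
def InA (δ : ℝ) (z₀ : ℂ) (r R : ℝ) (P : List (Site 2)) (x : Site 2) : Prop :=
  x ∉ P ∧ r < rad δ z₀ x ∧ rad δ z₀ x < R

/-- `x` and `y` lie in the same A-component: joined by a walk of non-past open-annulus vertices. -/
def JoinedInA (Ω : Set ℂ) (δ : ℝ) (z₀ : ℂ) (r R : ℝ) (P : List (Site 2)) (x y : Site 2) : Prop :=
  ∃ W : (discreteDomainGraph Ω δ).Walk x y, ∀ s ∈ W.support, InA δ z₀ r R P s

/-- The A-component of `x` is AVOIDABLE from the tip `v`: some walk from `v` to `b` avoids the past and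
that component after its start (KS: "does not disconnect `γ(τ)` from `b` in `U_τ`"). -/
def Avoidable (Ω : Set ℂ) (δ : ℝ) (z₀ : ℂ) (r R : ℝ) (P : List (Site 2)) (v b x : Site 2) : Prop :=
  ∃ e : (discreteDomainGraph Ω δ).Walk v b,
    ∀ y ∈ e.support.tail, y ∉ P ∧ ¬ JoinedInA Ω δ z₀ r R P y x

/-- **Targets** of the likelihood ratio after the prefix `η` (tip `v`): the non-past vertices `u` such
that (a) every past-avoiding walk `v ⇝ u` contains a traversal of `A(z₀,r,R)` whose first interior vertex
lies in an avoidable A-component (this excludes near traps at the tip and targets behind forced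
corridors), (b) the traversal index of `u` is STRICTLY larger than the tip's (some past-avoiding walk
`v ⇝ b` makes `≤ n` traversals while every past-avoiding walk `u ⇝ b` makes `≥ n+1`), and (c) the index of
`u` is finite (some past-avoiding walk `u ⇝ b` makes `< m` traversals: vertices sealed off from `b` are
not targets). -/
def Targets (Ω : Set ℂ) (δ : ℝ) (z₀ : ℂ) (r R : ℝ) {a v : Site 2}
    (η : (discreteDomainGraph Ω δ).Walk a v) (b : Site 2) : Set (Site 2) :=
  {u | u ∉ η.support ∧
    (∀ w : (discreteDomainGraph Ω δ).Walk v u, (∀ x ∈ w.support.tail, x ∉ η.support) →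
      ∃ i j, IsTraversal δ z₀ r R w i j ∧ Avoidable Ω δ z₀ r R η.support v b (w.getVert (i + 1))) ∧
    ∃ n m : ℕ, ¬ IdxAtLeast Ω δ z₀ r R η.support v b (n + 1) ∧
      IdxAtLeast Ω δ z₀ r R η.support u b (n + 1) ∧ ¬ IdxAtLeast Ω δ z₀ r R η.support u b m}

/-- **Dive event ("ever" form, KS Condition G3 strength)** after the prefix `η`: the chord extends `η` and
SOME traversal of `A(z₀,r,R)` by its future lands in `Targets η b`. -/
def DiveSet (Ω : Set ℂ) (δ : ℝ) (z₀ : ℂ) (r R : ℝ) {a v : Site 2}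
    (η : (discreteDomainGraph Ω δ).Walk a v) (b : Site 2) : Set (SAW.DomainSAW Ω δ a b) :=
  {γ | ∃ q : (discreteDomainGraph Ω δ).Walk v b, γ.walk = η.append q ∧
      ∃ i j, IsTraversal δ z₀ r R q i j ∧ q.getVert j ∈ Targets Ω δ z₀ r R η b}

/-- The canonical sequence of the first `n` traversals of the CLOCK annulus `A(z₀,r,R)` by the future
`q`: `E 0 = 0` and `E (m+1)` is the completion index of the first traversal that starts at or after `E m`. -/
def TravSeq {Ω : Set ℂ} (δ : ℝ) (z₀ : ℂ) (r R : ℝ) {v b : Site 2}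
    (q : (discreteDomainGraph Ω δ).Walk v b) (n : ℕ) (E : ℕ → ℕ) : Prop :=
  E 0 = 0 ∧ ∀ m, m < n → ∃ i, E m ≤ i ∧ IsTraversal δ z₀ r R q i (E (m + 1)) ∧
    ∀ i' j', E m ≤ i' → IsTraversal δ z₀ r R q i' j' → E (m + 1) ≤ j'

/-- **Charged-window event.**  Clock annulus `A(z₀, rc, Rc)` with canonical traversal times `E 0 … E n`;
`p` charges, the `k`-th judged at the clock time `E (mj k)` and carried by the annulus
`A(z₀, rch k, Rch k)`: the chord extends `η`, its future makes `n` clock traversals, and for every `k < p`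
some traversal of the `k`-th charged annulus by the future after `E (mj k)` lands in the targets JUDGED AT
THAT TIME and is completed no later than the next judging time `E (mj (k+1))` (no constraint for the last
charge). -/
def ChargedSet (Ω : Set ℂ) (δ : ℝ) (z₀ : ℂ) (rc Rc : ℝ) {a v : Site 2}
    (η : (discreteDomainGraph Ω δ).Walk a v) (b : Site 2) (n p : ℕ) (mj : ℕ → ℕ)
    (rch Rch : ℕ → ℝ) : Set (SAW.DomainSAW Ω δ a b) :=
  {γ | ∃ (q : (discreteDomainGraph Ω δ).Walk v b) (E : ℕ → ℕ), γ.walk = η.append q ∧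
      TravSeq δ z₀ rc Rc q n E ∧
      ∀ k, k < p → mj k ≤ n ∧
        ∃ i j, IsTraversal δ z₀ (rch k) (Rch k) (q.drop (E (mj k))) i j ∧
          (q.drop (E (mj k))).getVert j ∈
            Targets Ω δ z₀ (rch k) (Rch k) (η.append (q.take (E (mj k)))) b ∧
          (k + 1 < p → E (mj k) + j ≤ E (mj (k + 1)))}

/-! ## The two statements of the plumbing -/

/-- **UnforcedDiveBound — Kemppainen–Smirnov's Condition G2/G3 for the critical SAW, lattice-typed.**
For every Dobrushin domain, endpoint approximation and `ε > 0` there are an aspect ratio `C₀ > 2` and a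
mesh ceiling `δ₀ > 0` such that for `δ ≤ δ₀`, every annulus `A(z₀,r,R)` with `δ ≤ r`, `C₀ r ≤ R` and
every self-avoiding lattice prefix `η` from `a δ`: the weight of the chords extending `η` whose future EVER
makes a dive of `A` (a traversal landing in `Targets η (b δ)`) is at most `ε` times the weight of all
chords extending `η` (the power-law form G3: `ε(C₀) → 0`). -/
def UnforcedDiveBound : Prop :=
  ∀ (D : DobrushinDomain) (a b : ℝ → Site 2), SAW.IsEndpointApprox D a b → ∀ ε : ℝ, 0 < ε →
    ∃ C₀ δ₀ : ℝ, 2 < C₀ ∧ 0 < δ₀ ∧ ∀ δ ∈ Set.Ioc (0 : ℝ) δ₀,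
      ∀ (z₀ : ℂ) (r R : ℝ), δ ≤ r → C₀ * r ≤ R →
      ∀ (v : Site 2) (η : (discreteDomainGraph D.carrier δ).Walk (a δ) v), η.IsPath →
        SAW.weight D.carrier δ (a δ) (b δ) (DiveSet D.carrier δ z₀ r R η (b δ)) ≤
          ENNReal.ofReal ε * SAW.weight D.carrier δ (a δ) (b δ) (PrefixSet D.carrier δ (a δ) (b δ) η)

/-- **MultiDiveBound — charged windows along a clock annulus.**  Same `C₀(ε), δ₀(ε)`; for every clock
annulus and every list of `p` charges with strictly increasing judging indices and admissible charged
annuli (`δ ≤ rch k`, `C₀ · rch k ≤ Rch k`, common centre), the charged-window event costs `ε^p`. -/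
def MultiDiveBound : Prop :=
  ∀ (D : DobrushinDomain) (a b : ℝ → Site 2), SAW.IsEndpointApprox D a b → ∀ ε : ℝ, 0 < ε →
    ∃ C₀ δ₀ : ℝ, 2 < C₀ ∧ 0 < δ₀ ∧ ∀ δ ∈ Set.Ioc (0 : ℝ) δ₀,
      ∀ (z₀ : ℂ) (rc Rc : ℝ), δ ≤ rc → C₀ * rc ≤ Rc →
      ∀ (v : Site 2) (η : (discreteDomainGraph D.carrier δ).Walk (a δ) v), η.IsPath →
      ∀ (n p : ℕ) (mj : ℕ → ℕ) (rch Rch : ℕ → ℝ),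
        (∀ k, k + 1 < p → mj k < mj (k + 1)) → (∀ k, k < p → δ ≤ rch k ∧ C₀ * rch k ≤ Rch k) →
        SAW.weight D.carrier δ (a δ) (b δ) (ChargedSet D.carrier δ z₀ rc Rc η (b δ) n p mj rch Rch) ≤
          ENNReal.ofReal ε ^ p *
            SAW.weight D.carrier δ (a δ) (b δ) (PrefixSet D.carrier δ (a δ) (b δ) η)

/-! ## Registered stubs -/

/-- **Stub 1 (L) — the seed `TP2Gap`.**  Why plausibly true: conformally the two pairs are separated by a
quadrilateral of modulus `≥ (1/2π) log Λ₀` (the walk joining the deep pair inside `B̄(z₀,ρ)` and the walk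
joining the outer pair outside `B(z₀,Λ₀ρ)` are disjoint crosscuts; every curve between the opposite arcs
crosses `A(z₀,ρ,Λ₀ρ)`, KS Lemma 2.11), and for the conjectured limit kernel `ℓ(a)ℓ(b)H^{5/8}` the ratio
crossing/nested is a negative power of the cross-ratio, `→ 0`; data: `X(square) = 0.44, 0.38, 0.38,
0.38, 0.39` (`W = 2…6`, stable in the mesh), wall/door at aspect 2 `= 0.232, 0.185, 0.165`, slot `R_TP`
as above (long-rooms card, triage r1-1/2/3 re-derived).  Why it might fail: it is the one scale-free
STRICT inequality for SAW kernels on `ℤ²` and nothing like it is in print (Kesten's identity gives bridge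
masses `≤ 1`, never `< 1 - ε`); uniformity over fractal walls at all scales `≥ ρ₀δ` (roughness raises
`X`: `0.030 → 0.043` with a wall comb); the bet is that the re-pairing proof of `BoundaryTP2` is
quantitative in separated rooms.  Sources: card power-law-tp2; long-rooms-pair-short-sides K1;
arXiv:1212.6215 Lemma 2.11; doi:10.1007/s10955-016-1690-x (Lis, Ising TP via switching);
MadrasSlade1993 §4.2. -/
theorem stub_tp2Gap : TP2Gap := by
  sorry

/-- **Stub 2 (M) — Fekete: `BoundaryTP2 → TP2Gap → PTP`.**  Given `K`, take `k` with `θ^k ≤ 1/K`,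
`Λ := (2Λ₀)^{k+1}`, `ρ₀` from the seed.  In the room between `B̄(z₀,ρ)` and the exterior of `B(z₀,Λρ)`
choose doors `(q_i, q'_i)` = the two endpoints (boundary-adjacent vertices of `Ω_δ`) of the lattice
crosscut following the circle `|z - z₀| = ρ(2Λ₀)^i`, `i = 1..k`; the door lemma (TP₂ at `(q', m, q, d')`
and `(m', q, d, q')`) gives `X(Q) ≤ X(Q₀)X(Q₁)⋯X(Q_k)` (`crossRatioSubmult_of_boundaryTP2`, proved in
`Cruxes/TPToTraversalBound/Sketch.lean`, axioms standard), the seed gives `X(Q_i) ≤ θ` for the `k` inner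
sub-rooms (deep pair joined along the inner circle inside `B̄(z₀, ρ(2Λ₀)^i + δ)`, outer pair along the
next circle outside `B(z₀, Λ₀(ρ(2Λ₀)^i + δ))`), and `X ≤ 1` (TP₂) for the two end rooms.  Work: the
interlacing provisos of the sub-quadruples from those of `(p₁,p₂,p₃,p₄)` (planarity of `Ω_δ ⊆ ℤ²`,
discrete Jordan curve).  Why it might fail: only through lattice-level multiple connectivity of exotic
`Ω_δ` (Disproof F5), where the circle crosscuts need not separate and the chain stops (PTP itself is not
threatened).  Sources: card; triage r1-3 ("PTP ≡ TP2Gap + proved sub-multiplicativity"); Fekete. -/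
theorem stub_ptp_of_gap : BoundaryTP2 → TP2Gap → PTP := by
  sorry

/-- **Stub 3 (XL, HARDEST — the bet) — `BoundaryTP2 → CriticalBubbleBound → TP2Gap → PTP →
UnforcedDiveBound`.**  Intended proof.  (1) Localise: after `η`, the non-past annulus vertices split
into A-components; a dive passes through an avoidable component `P` and lands in the dead end `Y_P`
behind it (off the tip–`b δ` tree path; for a past attached to `∂D` the component/node adjacency is a
tree, for a floating past the index clause of `Targets` removes the one cycle).  (2) LOCAL SMLR (the
card's mechanism where it is true): let `ν` be an entrance time of `P` (stopping time: the future steps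
from `Y`'s far node into `P`), `J_P` = the targets behind `P`, `N = Σ_{c∈J_P} W_c/W_{b δ}` the
target-switching likelihood ratio (`dP_{J_P}/dP_b` on prefixes; exact domain Markov).  Claim:
`N_σ ≥ q(P) · N_ν` for every extension `κ` that traverses `P` from this entrance, `q(P) ≥ q₀ e^{c·m(P)}`,
`m(P)` = discrete modulus of `P` — all four partition functions have the SAME mouth, so tip factors,
areas of `Y_P` and route distances cancel (the global-`J`, time-`η` version is false and was discarded).
Proof of the claim: realise `Ω_δ ∖ past` (component of the tip) as `discreteDomainGraph Ω' δ`, `Ω'`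
bounded simply connected (thin closed tubes about the past mesh points joined to `∂D` by a
mesh-point-avoiding slit — slits are invisible to `closure`, Disproof F5); TP₂-MLR sandwich in `Ω'`
(cyclic order `(q, t, c, b)`: `Z_σ(t,c)Z_σ(q,b) ≥ Z_σ(q,c)Z_σ(t,b)`), PTP for the separated quadruple,
`TP2Gap` door by door along the split corridor for widths `≥ ρ₀δ` (strip subcriticality `μ_w < μ` below),
reverse Simon–Lieb `Z(x,y) ≥ Z(x,c⁺)Z(c⁻,y)/Z(c⁻,c⁺)` and one-step Harnack
`Z(x,y) ≤ (x_c⁻¹ + C_B)Z(x,y')` from the bubble constant; two squeezed crossing strands pay against one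
(card §Why-3: `c₁ ≈ 2c₂`).  (3) Optional stopping per `(P, entrance)`: the entrances after which the
traversal of `P` happens are disjoint events under `P_{J_P}`, so `P_b(dive through P) ≤ 1/q(P)`.
(4) Count pockets by extremal length: components of modulus `≤ m` crossing `A(z₀,r,C₀ r)` are `≤ 2π m /
log C₀` (parallel rule), so `Σ_P 1/q(P) ≤ (2π/(q₀ log C₀)) Σ_m (m+1)e^{-cm} ≤ ε` for `C₀ ≥ C₀(ε)`.
(5) "Ever" form: a target judged at `η` keeps index `≥ I(v)+1` as the past grows; a later dive above the
initial level from level `I(v) - s` costs `s+1` local gains.  (6) Interior `b δ` (allowed by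
`IsEndpointApprox`): last-step decomposition.  Why it might fail: (2) is a race between two constants of
the same kernel (triage r1-2 "self-declared bet"); (4) uses a discrete extremal-length count that must
come out of lattice geometry alone; many steps need the realisation `Ω'` and the lattice Jordan curve
theorem.  Numerics (card, exact at `x_c`, slots under 7×2…8×2 boxes): `inf N_σ/N_ν = 3.5, 13, 39, 120`
(aspect ¼…1), `≈ 40` at aspect 1 for `w = 2,3,4`, `≈ 1030–1150` at aspect 2; minimiser = wall-hugging
dive.  Sources: cards power-law-tp2 §Why-3, target-switching-smlr (OptionalStoppingLR); arXiv:1212.6215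
Def. 2.2, Lemma 2.11, Remark 2.8; MadrasSlade1993 §1.5; route items BoundaryHarnack/TPToHarnack;
KennedyLawler2013. -/
theorem stub_unforcedDive :
    BoundaryTP2 → CriticalBubbleBound → TP2Gap → PTP → UnforcedDiveBound := by
  sorry

/-- **Stub 4 (M) — nested optional stopping: `UnforcedDiveBound → MultiDiveBound`** (same `C₀(ε), δ₀(ε)`).
Induction on `p`.  Decompose the charged-window event along the antichain of prefixes
`η ++ q[0, E (mj 0)]` (canonical clock times are progressively determined, so chords with different
prefixes there are disjoint); inside one such prefix `η'` the first charge is a sub-event of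
`DiveSet … (rch 0) (Rch 0) η' (b δ)` (a traversal of the charged annulus landing in the targets judged at
`η'`), weight `≤ ε · W(ext η')` by the hypothesis AT `η'`; its completion before `E (mj 1)` makes it
decided by the next judging prefix, inside which the remaining `p - 1` charges (indices shifted) are
bounded by the induction hypothesis applied at that prefix (the statement is uniform in `η`); sum back
(`Σ_{η'} W(ext η') ≤ W(ext η)`).  Lean work: `Walk.take/drop/append/getVert` bookkeeping, heredity of
`TravSeq` under `drop`, `weight` = sum of Diracs on the `⊤` σ-algebra, ENNReal sums.
Sources: arXiv:1212.6215 p. 11 (G2 ⇒ G3: "trace the curve denoting by τ_j the ends of unforced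
crossings"); AizenmanBurchardDuke1999 §2.d. -/
theorem stub_multiDive_of_unforced : UnforcedDiveBound → MultiDiveBound := by
  sorry

/-- **Stub 5 (L–XL) — lattice Kemppainen–Smirnov Prop. 3.5 / Lemma 3.6 and Aizenman–Burchard:
`UnforcedDiveBound → MultiDiveBound → SAWTraversalBound`** (the raw dive bound is passed as well, so that
the prover may condition at adaptive stopping times where the pattern form is too rigid).  Fix `(D,a,b)`,
`ε := 1/64`, `C₀ = C₀(ε)`, `δ₀ = δ₀(ε)`.  For a shell `D(x;ρ,R)` with `R ≥ 4C₀³ρ` put `r := ρ + δ`,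
clock `A₂ = A(x, C₀ r, C₀² r)`, charged annuli `A₁ = A(x, r, C₀ r)`, `A₂`, `A₃ = A(x, C₀² r, C₀³ r)`.
(i) `Curve.HasTraversals k x ρ R` for the mesh polyline forces `k` lattice traversals of
`A(x, r, C₀³ r)` (parameter-disjoint AB segments each contain one; rounding by one mesh).  (ii) KS
Lemma 3.6 on the lattice: along the clock traversals the `A₂`-index changes by `±1` (opposite sides ⇒
odd; at most one because the future may return alongside the segment just traced — with the past attached
to `∂D` a width-one passage of `Ω_δ ∖ past` is a cut vertex, so sealing it traps the walk and trapped
prefixes carry no chord; the floating-past case needs the same for the doubly connected slit graph); two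
consecutive increases ⇒ the latter `A₂`-traversal lands in `Targets_{A₂}` judged at the earlier clock
time; a final increase ⇒ the next traversal of `A₁` or `A₃` lands in the corresponding targets judged at
the preceding clock time (KS's two bullet claims with "unforced" = index-increasing ∧ avoidable-interior,
the window form allowing ANY crossing in the window to be the charged one); hence a minimal crossing of
`A(x, r, C₀³ r)` with net index increase `2n'-1 ≥ 1` carries `≥ 2n'-1` charges, and `n` traversals carry
`≥ (n - n₀)/2`, `n₀` = index at time `0` (KS p. 15).  (iii) `n₀ ≤ m_D(x,ρ,R) < ∞` uniformly in
`δ ≤ δ₀` from the modulus of continuity of the Jordan boundary (as `⌊1/θ(ρ)⌋` in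
`Percolation.bondExploration_traversalBound_holds`) and `IsEndpointApprox`.  (iv) Probability: as in KS
Prop. 3.5, conditioning at the charges' judging times (pattern form `MultiDiveBound`, or adaptively from
`UnforcedDiveBound` with the big-annulus crossing times as the outer clock): `P(n traversals) ≤
c^{n} ε^{(n-n₀)/2}` with a combinatorial constant `c ≤ 4` (which clock step, which of three annuli), i.e.
`≤ 2^{-(n - 3n₀)}` for `ε = 1/64`.  (v) Constants: `k(x,ρ,R) := 3 m_D + ⌈3 log₂(R/ρ)⌉ + 4`, `λ := 3`,
`K := (4C₀³)^3` (for `R < 4C₀³ρ` the bound is `≥ 1 ≥` any probability, `Disproof.law_apply_le_one`), law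
= `(weight univ)⁻¹ • weight`.  Why it might fail: (ii) is KS's topological lemma re-proved for lattice
slit graphs with the index/avoidability dive notion (translation to be checked case by case; deep starts
weaken the `±1` step), and the rigorous form of KS's "(n-n₀)/2 applications of G3" needs the adaptive
conditioning of (iv).  Sources: arXiv:1212.6215 Prop. 3.5, Lemma 3.6 (held text pp. 14–15);
AizenmanBurchardDuke1999 App. A; `Literature.Probability.Percolation.bondExploration_traversalBound_holds`
(template); `CurveTortuosity.HasTraversals` API; `Disproof.traversalBound_iff_threshold_ge`,
`Disproof.allMesh_iff`. -/
theorem stub_traversalBound_of_multiDive :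
    UnforcedDiveBound → MultiDiveBound → SAWTraversalBound := by
  sorry

/-! ## Composition (kernel-checked; no `sorry` of its own) -/

/-- The pure-logic glue with the five stub statements as explicit hypotheses: the crux's own hypotheses
`BoundaryTP2`, `CriticalBubbleBound` feed stubs 2–3, and the chain 3 → 4 → 5 ends in `SAWTraversalBound`. -/
theorem glue (h₁ : TP2Gap) (h₂ : BoundaryTP2 → TP2Gap → PTP)
    (h₃ : BoundaryTP2 → CriticalBubbleBound → TP2Gap → PTP → UnforcedDiveBound)
    (h₄ : UnforcedDiveBound → MultiDiveBound)
    (h₅ : UnforcedDiveBound → MultiDiveBound → SAWTraversalBound) :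
    BoundaryTP2 → CriticalBubbleBound → SAWTraversalBound :=
  fun hTP hB =>
    have hU : UnforcedDiveBound := h₃ hTP hB h₁ (h₂ hTP h₁)
    h₅ hU (h₄ hU)

/-- **`TPToTraversalBound` from the five registered stubs** (concludes the crux BY NAME; depends on the
stubs' `sorry`s and on nothing else). -/
theorem TPToTraversalBound_of : TPToTraversalBound :=
  glue stub_tp2Gap stub_ptp_of_gap stub_unforcedDive stub_multiDive_of_unforced
    stub_traversalBound_of_multiDive

end

end Summit.CriticalPhenomena.SAWScalingLimit.Cruxes.TPToTraversalBound.PowerLawTp2
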